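import Literature.MathematicalPhysics.QuantumFieldTheory.Balaban1983to89.ClassLoopObservablesDenseIff
import Literature.MathematicalPhysics.QuantumFieldTheory.Balaban1983to89.TraceWordsSeparateOrbitsSymplectic
import Literature.LinearAlgebra.Matrix.SimultaneousConjugacyCompact
import HarnessLib

/-!
# THE LATTICE CRITERION IS SENGUPTA'S PROPERTY: on `ℤ^{d+2}` the class-function loop observables span ⟺
# `ProdConjDetermined G`; and `TraceWordsSeparateOrbits ρ ⟹ ProdConjDetermined G` — in particular
# `ProdConjDetermined Sp(n)` ([Yu2021] Thm 4.1(1); [Levy2004] Props 3.4–3.6; [Sengupta1994] Thm 2)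

statement-level skeleton of published theorems with citation tags; proofs where landed; nothing here is a claim about
the Yang–Mills mass gap

Cell `lit-balaban`, unit p24 gen 22, file F of the own-lane free target (G.5-34(d); no SKELETON row).  File D
(`ClassLoopObservablesDenseIff`, p359091) proved, for every compact metrisable `G`, «class-function loop observables span
on every `ℤ^{d+2}` ⟺ word-wise conjugate finite families are simultaneously conjugate» ([Levy2004] Prop. 3.6 with
Prop. 3.4's hypothesis: all words, letters and inverses).  File E (`Literature/LinearAlgebra/Matrix/SimultaneousConjugacyCompact`)
proved that in a compact group conjugacy of the non-empty POSITIVE products already gives conjugacy of all words, and that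
finite families suffice.  THIS FILE closes the circle with the tree's group property `ProdConjDetermined G`
([Sengupta1994] Thm 2's form, `SimultaneousConjugacyProducts`):

* §1 `wordVal_pair`, **`isConj_wordVal_of_isConj_prod`** (compact `G`: positive-product conjugacy ⟹ `IsConj (w V) (w W)`
  for every word `w`), **`prodConjDetermined_iff_wordConj`**: for compact Hausdorff `G`, `ProdConjDetermined G` ⟺ file D's
  word criterion;
* §2 **`prodConjDetermined_of_traceWordsSeparateOrbits`**: for a compact Hausdorff group, module XXI's one-representation
  schema `TraceWordsSeparateOrbits ρ` (any `ρ`) IMPLIES `ProdConjDetermined G` (positive products conjugate ⟹ all words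
  conjugate ⟹ equal word traces ⟹ simultaneously conjugate; finite families suffice) — hence, from gen 19's
  `traceWordsSeparateOrbits_symplecticGroup` (p339951) and `…_formUnitaryGroup`:
  **`prodConjDetermined_symplecticGroup n : ProdConjDetermined Sp(n)`** ([Yu2021] Thm 4.1(1): `Sp(n)` is acceptable — the
  tree's `SimultaneousConjugacyProducts` list `U(n)`, `SU(n)`, `O(n)`, `SO(2n+1)`, `SO(4)` thus gains `Sp(n)` and every
  `G_J = {g ∈ U(N) : gᵀJg = J}`, `J` unitary, `Jᵀ = ±J`);
* §3 **`spansGaugeInvariantCylinders_classLoopProducts_iff_prodConjDetermined`**: for every compact metrisable `G`,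
  `(∀ d, SpansGaugeInvariantCylinders (d+2) (classLoopProducts (d+2) G)) ⟺ ProdConjDetermined G` — module XIX's density
  schema for gen 20's class of all class-function loop products IS Sengupta's property; instance `Sp(n)` (the natural-
  representation cell, sharper, is p339951's `spansGaugeInvariantCylinders_symplecticGroup`).

HONEST SCOPE.  Compact Hausdorff (second countable for §3) groups; `ProdConjDetermined.{u,0}` (families indexed by small
types; file E's `prodConjDetermined_univ_of_zero` lifts universes).  Nothing about convergence at any `β`; NOT summit
progress.

## References

* [Levy2004] T. Lévy, J. Geom. Phys. 52 (2004) 382–397 (arXiv:math-ph/0306059 pagination): Props 3.4, 3.5, 3.6 p.5.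
* [Sengupta1994] A. Sengupta, Proc. AMS 121 (1994) 897–905, Thm 2 p.900.
* [Yu2021] J. Yu, *Acceptable compact Lie groups*, Peking Math. J. 5 (2021), Thm 1.1 and Thm 4.1(1) (`Sp(n)`).
-/

noncomputable section

open Filter Topology
open scoped Matrix

namespace Literature.MathematicalPhysics.QuantumFieldTheory.Balaban1983to89.ClassLoopObservablesDenseIffProdConj

open Literature.MathematicalPhysics.QuantumLattice
open Literature.Probability.LatticeModels (zdGraph)
open Balaban1983to89.Missing (SpansGaugeInvariantCylinders TraceWordsSeparateOrbits)
open ClassLoopObservablesNotDenseSO8 (classLoopProducts)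
open ClassLoopObservablesDenseIff (spansGaugeInvariantCylinders_classLoopProducts_iff wordConj_of_prodConjDetermined)
open TraceWordsSeparateOrbitsSymplectic (formUnitaryGroup formUnitaryRep sympJ symplecticRep
  traceWordsSeparateOrbits_formUnitaryGroup traceWordsSeparateOrbits_symplecticGroup)
open Literature.LinearAlgebra.Matrix (ProdConjDetermined)
open Literature.LinearAlgebra.Matrix.SimultaneousConjugacyCompact (isConj_of_mem_subgroupClosure
  prodConjDetermined_of_finite)

universe u v

/-! ## §1 Positive products versus words; `ProdConjDetermined` ⟺ the word criterion -/

section Words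

variable {G : Type u} [Group G] {ι : Type*}

/-- A word evaluated at the family of PAIRS is the pair of its values. [cite: Levy2004, Example 3.3 p.5 (w(g))] -/
theorem wordVal_pair (V W : ι → G) :
    ∀ w : List (ι × Bool), wordVal w (fun i => ((V i, W i) : G × G)) = (wordVal w V, wordVal w W)
  | [] => by simp; rfl
  | a :: w => by
    rw [wordVal_cons, wordVal_cons, wordVal_cons, wordVal_pair V W w]
    rcases a with ⟨i, _ | _⟩ <;> simp [letterVal]

/-- The value of a word lies in the subgroup generated by the letters. [cite: Levy2004, Example 3.3 p.5] -/
private theorem wordVal_mem_closure (w : List (ι × Bool)) (V : ι → G) :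
    wordVal w V ∈ Subgroup.closure (Set.range V) := by
  induction w with
  | nil => rw [wordVal_nil]; exact one_mem _
  | cons a w ih =>
    rw [wordVal_cons]
    refine mul_mem ?_ ih
    rcases a with ⟨i, _ | _⟩
    · exact inv_mem (Subgroup.subset_closure ⟨i, rfl⟩)
    · exact Subgroup.subset_closure ⟨i, rfl⟩

variable [TopologicalSpace G] [IsTopologicalGroup G] [CompactSpace G] [T2Space G]

/-- **COMPACT `G`: CONJUGACY OF THE POSITIVE PRODUCTS GIVES CONJUGACY OF ALL WORDS** (file E's
`isConj_of_mem_subgroupClosure` at the word `w`). [cite: Sengupta1994, Thm 2 p.900 («It is only this apparently weaker hypothesis that will be used»); Levy2004, Prop 3.4 p.5] -/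
theorem isConj_wordVal_of_isConj_prod (V W : ι → G)
    (h : ∀ l : List ι, l ≠ [] → IsConj (l.map V).prod (l.map W).prod) (w : List (ι × Bool)) :
    IsConj (wordVal w V) (wordVal w W) := by
  have hmem := wordVal_mem_closure w fun i => ((V i, W i) : G × G)
  rw [wordVal_pair] at hmem
  exact isConj_of_mem_subgroupClosure V W h hmem

/-- **FOR A COMPACT HAUSDORFF GROUP, `ProdConjDetermined G` ⟺ FILE D's WORD CRITERION** (positive products ⟺ words by
file E §1; arbitrary ⟺ finite families by file E §2). [cite: Sengupta1994, Thm 2 p.900; Levy2004, Props 3.4–3.5 p.5] -/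
theorem prodConjDetermined_iff_wordConj :
    ProdConjDetermined.{u, 0} G ↔ ∀ (r : ℕ) (V W : Fin r → G),
      (∀ w : List (Fin r × Bool), IsConj (wordVal w V) (wordVal w W)) → ∃ g : G, ∀ i, W i = g * V i * g⁻¹ := by
  refine ⟨fun hG r V W h => wordConj_of_prodConjDetermined hG r V W h, fun h => ?_⟩
  refine prodConjDetermined_of_finite fun r V W hVW => h r V W (isConj_wordVal_of_isConj_prod V W fun l hl => ?_)
  obtain ⟨y, hy⟩ := hVW l hl
  exact isConj_iff.2 ⟨y, hy.symm⟩

end Words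

/-! ## §2 `TraceWordsSeparateOrbits ρ ⟹ ProdConjDetermined G`; the symplectic groups -/

section TraceWords

variable {G : Type u} [Group G] [TopologicalSpace G] [IsTopologicalGroup G] [CompactSpace G] [T2Space G] {N : ℕ}

/-- **ONE-REPRESENTATION ORBIT SEPARATION IMPLIES SENGUPTA'S PROPERTY** for a compact Hausdorff group: if the word
traces of some representation `ρ` separate the simultaneous-conjugation orbits (module XXI's `TraceWordsSeparateOrbits ρ`),
then families with conjugate non-empty positive products are simultaneously conjugate (`ProdConjDetermined G`, every
index type) — positive products conjugate ⟹ all words conjugate (§1) ⟹ equal `Re/Im tr ρ` of all words (`tracePart` is a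
class function) ⟹ conjugate by the schema; finite families suffice (file E). [cite: Sengupta1994, Thm 2 p.900; Levy2004, Props 3.4–3.5 p.5] -/
theorem prodConjDetermined_of_traceWordsSeparateOrbits (ρ : G →* Matrix (Fin N) (Fin N) ℂ)
    (hsep : TraceWordsSeparateOrbits ρ) : ProdConjDetermined.{u, v} G := by
  refine prodConjDetermined_of_finite fun r V W hVW => hsep (Fin r) V W fun w b => ?_
  have hc : IsConj (wordVal w V) (wordVal w W) := isConj_wordVal_of_isConj_prod V W (fun l hl => by
    obtain ⟨y, hy⟩ := hVW l hl
    exact isConj_iff.2 ⟨y, hy.symm⟩) w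
  obtain ⟨c, hc⟩ := isConj_iff.1 hc
  rw [← hc, tracePart_conj]

/-- **`G_J = {g ∈ U(N) : gᵀ J g = J}`, `J` unitary with `Jᵀ = ±J`, has Sengupta's property** (gen 19's
`traceWordsSeparateOrbits_formUnitaryGroup`). [cite: Levy2004, Prop 3.4 p.5; Sengupta1994, Thm 2 p.900] -/
theorem prodConjDetermined_formUnitaryGroup (J : Matrix (Fin N) (Fin N) ℂ) (hJ : J ∈ Matrix.unitaryGroup (Fin N) ℂ)
    (hJT : Jᵀ = J ∨ Jᵀ = -J) : ProdConjDetermined.{0, v} ↥(formUnitaryGroup J) :=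
  prodConjDetermined_of_traceWordsSeparateOrbits (formUnitaryRep J) (traceWordsSeparateOrbits_formUnitaryGroup J hJ hJT)

/-- **`Sp(n)` HAS SENGUPTA'S PROPERTY: `ProdConjDetermined Sp(n)`** (`Sp(n) = U(2n) ∩ Sp(2n, ℂ)` as gen 19's
`formUnitaryGroup (sympJ n)`): families in `Sp(n)` whose non-empty products are conjugate in `Sp(n)` are simultaneously
`Sp(n)`-conjugate — [Levy2004] Prop. 3.4 p.5 for `G = Sp(n)` («Let G be a group as in Theorem 3.1 [U(n), SU(n), O(n),
SO(n), Sp(n)] … then g and g′ belong to the same diagonal conjugacy class») in [Sengupta1994]'s product form (positive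
products, arbitrary families: file E); cf. [Yu2021] Thm 4.1(1) («U(n), SU(n), Sp(n), O(n), SO(2n+1)» are strongly
acceptable).  With the tree's `U(n)`, `SU(n)`, `O(n)`, `SO(2n+1)` (`SimultaneousConjugacyProducts`) and `SO(4)` (gen 21)
the classical compact list is complete. [cite: Levy2004, Prop 3.4 p.5 (G = Sp(n)); Yu2021, Thm 4.1(1)] -/
theorem prodConjDetermined_symplecticGroup (n : ℕ) : ProdConjDetermined.{0, v} ↥(formUnitaryGroup (sympJ n)) :=
  prodConjDetermined_of_traceWordsSeparateOrbits (symplecticRep n) (traceWordsSeparateOrbits_symplecticGroup n)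

end TraceWords

/-! ## §3 The lattice criterion is Sengupta's property -/

section Lattice

variable {G : Type u} [Group G] [TopologicalSpace G] [IsTopologicalGroup G] [CompactSpace G] [T2Space G]
  [MeasurableSpace G] [BorelSpace G] [SecondCountableTopology G]

/-- **HEADLINE — ON `ℤ^{d+2}` THE CLASS-FUNCTION LOOP OBSERVABLES SPAN ⟺ `ProdConjDetermined G`** (every compact
metrisable `G`): module XIX's density schema for gen 20's class of all class-function loop products holds in every
dimension `d + 2` iff `G` has [Sengupta1994] Thm 2's property (file D's criterion ∘ §1).  Tree census: TRUE for `U(n)`,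
`SU(n)`, `O(n)`, `SO(2n+1)`, `SO(4)`, `Sp(n)`, `G_J`, abelian groups and products; FALSE for `SO(2m)`, `m ≥ 3`.
[cite: Levy2004, Prop 3.6 p.5 («Theorem (main) is logically equivalent to … Proposition 3.4»); Sengupta1994, Thm 2 p.900] -/
theorem spansGaugeInvariantCylinders_classLoopProducts_iff_prodConjDetermined :
    (∀ d : ℕ, SpansGaugeInvariantCylinders (d + 2) (classLoopProducts (d + 2) G)) ↔ ProdConjDetermined.{u, 0} G := by
  rw [prodConjDetermined_iff_wordConj]
  exact spansGaugeInvariantCylinders_classLoopProducts_iff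

/-- **`Sp(n)`**: the class-function loop products span on every `ℤ^{d+2}` (the natural-representation Wilson loops already
do: gen 19's `spansGaugeInvariantCylinders_symplecticGroup`; recorded here as the instance of the criterion).
[cite: Levy2004, Thm 3.1 p.5; Yu2021, Thm 4.1(1)] -/
theorem spansGaugeInvariantCylinders_classLoopProducts_symplecticGroup (n d : ℕ) :
    SpansGaugeInvariantCylinders (d + 2) (classLoopProducts (d + 2) ↥(formUnitaryGroup (sympJ n))) := by
  haveI : SecondCountableTopology ↥(formUnitaryGroup (sympJ n)) := by
    haveI : SecondCountableTopology (Matrix (Fin (n + n)) (Fin (n + n)) ℂ) :=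
      inferInstanceAs (SecondCountableTopology (Fin (n + n) → Fin (n + n) → ℂ))
    haveI : SecondCountableTopology (Matrix.unitaryGroup (Fin (n + n)) ℂ) :=
      Topology.IsEmbedding.subtypeVal.secondCountableTopology
    exact Topology.IsEmbedding.subtypeVal.secondCountableTopology
  exact spansGaugeInvariantCylinders_classLoopProducts_iff_prodConjDetermined.2 (prodConjDetermined_symplecticGroup n) d

end Lattice

end Literature.MathematicalPhysics.QuantumFieldTheory.Balaban1983to89.ClassLoopObservablesDenseIffProdConj
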